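import Mathlib
import Literature.Analysis.FluidPDE.ClassicalGradientSmoothing
import Literature.Analysis.FluidPDE.KNSSMildGradientBound
import Literature.Analysis.FluidPDE.OseenHeatKernelBridge
import Summits.NavierStokesRegularity.NavierStokesRegularity.Theorems.LevelSetModerationHighSpeedPressureWorkLateBookkeeping

/-!
# Route LevelSetModeration — `HighSpeedPressureWork`: the scale-invariant early gradient bound

Support file for item stmt-NavierStokesRegularity-18149 (`HighSpeedPressureWork`), line
`iso-speed-area-closure`, stub `stub_earlyBookkeeping` (L3-E), ingredient (b) of the brief: the
SCALE-INVARIANT first-order smoothing of the data class from `t = 0`,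

  `‖∇u(t, x)‖ ≤ C G / √(ν t)`   for `0 < t ≤ ν/G²`, under a speed bound `G` on `[0, T']`,

i.e. KNSS 2009 (4.6) with `k = 1`, `l = 0`, LINEAR in the bound (contrast the delayed form
`‖∇u(t)‖ ≤ C G²/ν` for `t > ν/G²`, `exists_norm_fderiv_le_of_speed_le`, which after the trick
`G ↦ √(ν/t)` only gives `C/t`). Assembly of landed bricks:

* `earlyBookkeeping_norm_fderiv_le_unit` — unit viscosity and unit bound on `(0, T] ⊂ (0, b)`:
  `‖∇u(t,x)‖ ≤ C/√t` for `0 < t ≤ 1`, `t < T`. The cut-off field is restarted-mild with zero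
  drift (`IsKNSSDriftMild T 1 U 0`: `mild_of_bounded_of_eLpNorm_two_le_of_lt`, KNSS Lemma 3.1 +
  finite energy; `driftDuhamel_zero_eq_oseenDuhamel`; classical slices are weakly divergence
  free), and `IsKNSSDriftMild.exists_gradient_bound` ((4.6), `k = 1`) is applied from `s = t/2`.
* `earlyBookkeeping_norm_fderiv_le_of_speed_le` — general `ν, G` by the parabolic scaling
  `u ↦ G⁻¹u(νt/G², νx/G)` (`IsClassicalNSSolutionOn.stRescale`, as in
  `exists_norm_fderiv_le_of_speed_le`).
* `earlyBookkeeping_norm_fderiv_le` — the data class of the crux: one absolute pair `(C, ε')`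
  with `‖∇u(τ,x)‖ ≤ C B₀/√(ντ)` for every classical Leray–Hopf solution with `|u₀| ≤ B₀`
  (`B₀ > 0`) and all `τ ∈ (0,T)`, `τ < ε'ν/B₀²` (speed `≤ 2B₀` in the early window,
  `levelSetModeration_earlyWindow`; `L²` slice bound from the energy inequality).
-/

noncomputable section

-- single-conjunct summit: `Summit.<Summit>.<Problem>` repeats the name by the D-0017 layout
set_option linter.dupNamespace false

namespace Summit.NavierStokesRegularity.NavierStokesRegularity.Theorems

open MeasureTheory Set Filter Topology Function
open scoped ENNReal
open Literature.Analysis.FluidPDE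

/-! ### Unit viscosity, unit bound -/

/-- **Scale-invariant gradient bound, unit form** (KNSS 2009 (4.6), `k = 1`, `l = 0`, for bounded
finite-energy classical solutions): there is `C ≥ 0` such that every classical solution of the
unforced Navier–Stokes system (`ν = 1`) on `ℝ³ × (0, b)` with `‖u‖ ≤ 1` on `(0, T] × ℝ³`, `T < b`,
and `‖u(t)‖_{L²} ≤ K < ∞` there satisfies `‖∇u(t, x)‖ ≤ C/√t` for all `x` and all `t ∈ (0, T)`
with `t ≤ 1`. [cite: KochNadirashviliSereginSverak2009, §4 Prop. 4.1, (4.6) (arXiv:0709.3599v1 p. 8)] -/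
theorem earlyBookkeeping_norm_fderiv_le_unit :
    ∃ C : ℝ, 0 ≤ C ∧ ∀ {b T : ℝ} {u : ℝ → EuclideanSpace ℝ (Fin 3) → EuclideanSpace ℝ (Fin 3)}
      {p : ℝ → EuclideanSpace ℝ (Fin 3) → ℝ}, IsClassicalNSSolutionOn (Ioo 0 b) 1 0 u p →
      0 < T → T < b → (∀ t ∈ Ioc 0 T, ∀ x, ‖u t x‖ ≤ 1) → ∀ {K : ℝ≥0∞}, K ≠ ∞ →
      (∀ t ∈ Ioc 0 T, eLpNorm (u t) 2 volume ≤ K) →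
      ∀ t ∈ Ioo 0 T, t ≤ 1 → ∀ x, ‖fderiv ℝ (u t) x‖ ≤ C / Real.sqrt t := by
  obtain ⟨C, hC0, hC⟩ :=
    IsKNSSDriftMild.exists_gradient_bound (E := EuclideanSpace ℝ (Fin 3)) finrank_euclideanSpace_fin
  refine ⟨2 * C, by positivity, ?_⟩
  intro b T u p hcl hT hTb hbd K hK hL2 t ht ht1 x
  classical
  -- the cut-off field
  set S : Set (ℝ × EuclideanSpace ℝ (Fin 3)) := Ioo 0 T ×ˢ univ with hS
  set U : ℝ → EuclideanSpace ℝ (Fin 3) → EuclideanSpace ℝ (Fin 3) :=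
    fun τ y => if τ ∈ Ioo 0 T then u τ y else 0 with hU
  have hUeq : ∀ {τ : ℝ}, τ ∈ Ioo 0 T → U τ = u τ := by
    intro τ hτ; funext y; simp only [hU, if_pos hτ]
  have hUunc : uncurry U = S.piecewise (uncurry u) 0 := by
    funext z
    obtain ⟨τ, y⟩ := z
    by_cases hτ : τ ∈ Ioo 0 T
    · have hz : (τ, y) ∈ S := mk_mem_prod hτ (mem_univ y)
      simp only [uncurry_apply_pair, hU, if_pos hτ, piecewise_eq_of_mem _ _ _ hz]
    · have hz : (τ, y) ∉ S := fun h => hτ (mem_prod.1 h).1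
      simp only [uncurry_apply_pair, hU, if_neg hτ, piecewise_eq_of_notMem _ _ _ hz,
        Pi.zero_apply]
  have hmeas : Measurable (uncurry U) := by
    rw [hUunc]
    refine ContinuousOn.measurable_piecewise ?_ continuousOn_const
      (measurableSet_Ioo.prod MeasurableSet.univ)
    exact hcl.smooth_velocity.continuousOn.mono (prod_mono (Ioo_subset_Ioo_right hTb.le) subset_rfl)
  have hIoo : ∀ {τ : ℝ}, τ ∈ Ioo 0 T → τ ∈ Ioo 0 b := fun hτ => ⟨hτ.1, hτ.2.trans hTb⟩
  -- it is restarted-mild with zero drift and bound `1`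
  have hDM : IsKNSSDriftMild T 1 U 0 := by
    refine IsKNSSDriftMild.mk measurable_const (fun _ => by simp) hmeas ?_ ?_ ?_
    · intro τ hτ y
      rw [hUeq hτ]
      exact hbd τ ⟨hτ.1, hτ.2.le⟩ y
    · refine (ae_restrict_iff' measurableSet_Ioo).2 (Eventually.of_forall fun τ hτ => ?_)
      rw [hUeq hτ]
      exact VectorCalculus.IsDivFree.isWeaklyDivFree_holds (hcl.divFree τ (hIoo hτ))
        (contDiff_infty.1 (hcl.contDiff_velocity (hIoo hτ)) 1)
    · intro s t' hs hst ht' y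
      have hsI : s ∈ Ioo 0 T := ⟨hs, hst.trans ht'⟩
      have htI : t' ∈ Ioo 0 T := ⟨hs.trans hst, ht'⟩
      have hmem : ∀ {σ : ℝ}, σ ∈ Ioo s t' → σ ∈ Ioo 0 T := fun hσ =>
        ⟨hs.trans hσ.1, hσ.2.trans ht'⟩
      have hVm : ∀ σ ∈ Ioo s t', Measurable (U σ) := fun σ hσ => by
        rw [hUeq (hmem hσ)]
        exact (hcl.contDiff_velocity (hIoo (hmem hσ))).continuous.measurable
      have hVN : ∀ σ ∈ Ioo s t', ∀ z, ‖U σ z‖ ≤ 1 := fun σ hσ z => by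
        rw [hUeq (hmem hσ)]
        exact hbd σ ⟨hs.trans hσ.1, (hσ.2.trans ht').le⟩ z
      rw [driftDuhamel_zero_eq_oseenDuhamel finrank_euclideanSpace_fin hVm hVN hst.le y, hUeq htI,
        hUeq hsI]
      have hcongr : oseenDuhamel 1 s U U t' y = oseenDuhamel 1 s u u t' y :=
        LongLivedOseenSolution.oseenDuhamel_congr (fun τ hτ => hUeq (hmem hτ))
          (fun τ hτ => hUeq (hmem hτ)) y
      rw [hcongr]
      exact mild_of_bounded_of_eLpNorm_two_le_of_lt hcl hT hTb hbd hK hL2 hs hst ht' y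
  -- the gradient bound from `s = t/2`
  have hs : 0 < t / 2 := by linarith [ht.1]
  have hst : t / 2 < t := by linarith [ht.1]
  have hwin : (1 : ℝ) ^ 2 * (t - t / 2) ≤ 1 := by rw [one_pow, one_mul]; linarith
  have key := hC hDM hs hst ht.2 hwin x
  rw [hUeq ht, mul_one, show t - t / 2 = t / 2 by ring, ← Real.sqrt_eq_rpow] at key
  have hpos : 0 < Real.sqrt (t / 2) := Real.sqrt_pos.2 hs
  have hpos' : 0 < Real.sqrt t := Real.sqrt_pos.2 ht.1
  have h1 : ‖fderiv ℝ (u t) x‖ ≤ C / Real.sqrt (t / 2) := by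
    rw [le_div_iff₀ hpos, mul_comm]; exact key
  refine h1.trans ?_
  rw [div_le_div_iff₀ hpos hpos']
  have h2 : Real.sqrt t ≤ 2 * Real.sqrt (t / 2) := by
    have h3 : (2 : ℝ) * Real.sqrt (t / 2) = Real.sqrt (2 ^ 2 * (t / 2)) := by
      rw [Real.sqrt_mul (by norm_num), Real.sqrt_sq (by norm_num : (0 : ℝ) ≤ 2)]
    rw [h3]
    exact Real.sqrt_le_sqrt (by linarith [ht.1])
  calc C * Real.sqrt t ≤ C * (2 * Real.sqrt (t / 2)) := mul_le_mul_of_nonneg_left h2 hC0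
    _ = 2 * C * Real.sqrt (t / 2) := by ring

/-! ### General viscosity and bound: the scale-invariant form -/

/-- **Scale-invariant gradient bound under a speed bound.** There is an absolute `C ≥ 0` such
that: for `ν > 0`, `G > 0`, every classical solution of the unforced Navier–Stokes system with
viscosity `ν` on `ℝ³ × [0, T)` that is bounded by `G` on `[0, T'] × ℝ³` (`T' < T`) and has
uniformly square-integrable slices there satisfies `‖∇u(t, x)‖ ≤ C G/√(νt)` for all `x` and all
`t ∈ (0, T')` with `t ≤ ν/G²` (scaling `u ↦ G⁻¹u(νt/G², νx/G)` of
`earlyBookkeeping_norm_fderiv_le_unit`). [cite: KochNadirashviliSereginSverak2009, §4 Prop. 4.1, (4.6) (arXiv:0709.3599v1 p. 8)] -/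
theorem earlyBookkeeping_norm_fderiv_le_of_speed_le :
    ∃ C : ℝ, 0 ≤ C ∧ ∀ {ν T T' G : ℝ} {u : ℝ → EuclideanSpace ℝ (Fin 3) → EuclideanSpace ℝ (Fin 3)}
      {p : ℝ → EuclideanSpace ℝ (Fin 3) → ℝ}, 0 < ν → 0 < G →
      IsClassicalNSSolutionOn (Ico 0 T) ν 0 u p → 0 < T' → T' < T →
      (∀ t ∈ Icc 0 T', ∀ x, ‖u t x‖ ≤ G) → ∀ {K : ℝ≥0∞}, K ≠ ∞ →
      (∀ t ∈ Icc 0 T', eLpNorm (u t) 2 volume ≤ K) →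
      ∀ t ∈ Ioo 0 T', t ≤ ν / G ^ 2 → ∀ x, ‖fderiv ℝ (u t) x‖ ≤ C * G / Real.sqrt (ν * t) := by
  obtain ⟨C₁, hC₁0, hC₁⟩ := earlyBookkeeping_norm_fderiv_le_unit
  refine ⟨C₁, hC₁0, ?_⟩
  intro ν T T' G u p hν hG hcl hT' hT'T hbd K hK hL2 t ht htν x
  -- scaling parameters
  set α : ℝ := G⁻¹ with hα
  set γ : ℝ := ν / G with hγ
  set β : ℝ := ν / G ^ 2 with hβ
  have hαpos : 0 < α := by rw [hα]; positivity
  have hγpos : 0 < γ := by rw [hγ]; positivity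
  have hβpos : 0 < β := by rw [hβ]; positivity
  have hβαγ : β = α * γ := by rw [hβ, hα, hγ]; field_simp
  -- the rescaled classical solution, unit viscosity, on `(0, T/β)`
  have hcl' := (hcl.mono Ioo_subset_Ico_self (uniqueDiffOn_Ioo 0 T)).stRescale hαpos hγpos hβαγ 0 0
  have hS : ((fun r => (0 : ℝ) + β * r) ⁻¹' Ioo 0 T) = Ioo 0 (T / β) := by
    ext r
    simp only [mem_preimage, mem_Ioo, zero_add]
    constructor
    · rintro ⟨h1, h2⟩
      exact ⟨(mul_pos_iff_of_pos_left hβpos).1 h1, (lt_div_iff₀' hβpos).2 h2⟩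
    · rintro ⟨h1, h2⟩
      exact ⟨mul_pos hβpos h1, (lt_div_iff₀' hβpos).1 h2⟩
  have hν1 : α * ν / γ = 1 := by rw [hα, hγ]; field_simp
  rw [hS, hν1, smul_stPull_zero] at hcl'
  set w : ℝ → EuclideanSpace ℝ (Fin 3) → EuclideanSpace ℝ (Fin 3) := α • stPull β γ 0 0 u with hw
  -- bounds for `w` on `(0, T'/β]`
  have hwapp : ∀ s y, w s y = α • u (β * s) (γ • y) := by
    intro s y
    simp only [hw, Pi.smul_apply, stPull_apply, zero_add]
  have hT'β : 0 < T' / β := div_pos hT' hβpos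
  have hT'βT : T' / β < T / β := div_lt_div_of_pos_right hT'T hβpos
  have hmemI : ∀ {s : ℝ}, s ∈ Ioc 0 (T' / β) → β * s ∈ Icc 0 T' := by
    intro s hs
    refine ⟨(mul_pos hβpos hs.1).le, ?_⟩
    have := hs.2
    rwa [le_div_iff₀' hβpos] at this
  have hbd' : ∀ s ∈ Ioc 0 (T' / β), ∀ y, ‖w s y‖ ≤ 1 := by
    intro s hs y
    rw [hwapp, norm_smul, Real.norm_of_nonneg hαpos.le, hα]
    have := hbd (β * s) (hmemI hs) (γ • y)
    calc G⁻¹ * ‖u (β * s) (γ • y)‖ ≤ G⁻¹ * G := by gcongr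
      _ = 1 := inv_mul_cancel₀ hG.ne'
  set K' : ℝ≥0∞ := ENNReal.ofReal |α| * (ENNReal.ofReal (γ ^ 3)⁻¹) ^ (1 / 2 : ℝ) * K with hK'
  have hK'top : K' ≠ ⊤ := by
    refine ENNReal.mul_ne_top (ENNReal.mul_ne_top ENNReal.ofReal_ne_top ?_) hK
    exact ENNReal.rpow_ne_top_of_nonneg (by norm_num) ENNReal.ofReal_ne_top
  have hL2' : ∀ s ∈ Ioc 0 (T' / β), eLpNorm (w s) 2 volume ≤ K' := by
    intro s hs
    have h1 : w s = fun y => α • u (β * s) ((0 : EuclideanSpace ℝ (Fin 3)) + γ • y) := by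
      funext y; rw [hwapp, zero_add]
    rw [h1]
    refine (eLpNorm_two_smul_comp_affine_le α hγpos 0).trans ?_
    rw [hK']
    gcongr
    exact hL2 (β * s) (hmemI hs)
  -- the unit estimate for `w` at time `t/β ∈ (0, 1]`
  have htβ : t / β ∈ Ioo 0 (T' / β) := ⟨div_pos ht.1 hβpos, div_lt_div_of_pos_right ht.2 hβpos⟩
  have htβ1 : t / β ≤ 1 := by rw [div_le_one hβpos]; exact htν
  have key := hC₁ hcl' hT'β hT'βT hbd' hK'top hL2' (t / β) htβ htβ1 (γ⁻¹ • x)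
  -- undo the scaling in the derivative
  have htT : t ∈ Ico 0 T := ⟨ht.1.le, ht.2.trans hT'T⟩
  have hdiff : DifferentiableAt ℝ (stPull β γ 0 0 u (t / β)) (γ⁻¹ • x) :=
    differentiable_stPull_slice
      (((hcl.contDiff_velocity (by simpa [mul_div_cancel₀ _ hβpos.ne'] using htT)).differentiable
        (by simp))) _
  have hD : fderiv ℝ (w (t / β)) (γ⁻¹ • x) = (α * γ) • fderiv ℝ (u t) x := by
    have h1 : w (t / β) = α • stPull β γ 0 0 u (t / β) := rfl
    rw [h1, fderiv_const_smul hdiff, fderiv_stPull, smul_smul]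
    congr 2
    · rw [zero_add, mul_div_cancel₀ _ hβpos.ne']
    · rw [zero_add, smul_smul, mul_inv_cancel₀ hγpos.ne', one_smul]
  rw [hD, norm_smul, Real.norm_of_nonneg (by positivity)] at key
  -- `α γ = ν / G²`, `√(t/β) = G √(t/ν)`, `√(ν t) = ν √(t/ν)`
  have hαγ : α * γ = ν / G ^ 2 := by rw [hα, hγ]; field_simp
  have hsq : Real.sqrt (t / β) = G * Real.sqrt (t / ν) := by
    rw [hβ, show t / (ν / G ^ 2) = G ^ 2 * (t / ν) by field_simp, Real.sqrt_mul (sq_nonneg G),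
      Real.sqrt_sq hG.le]
  have hsq' : Real.sqrt (ν * t) = ν * Real.sqrt (t / ν) := by
    rw [show ν * t = ν ^ 2 * (t / ν) by field_simp, Real.sqrt_mul (sq_nonneg ν),
      Real.sqrt_sq hν.le]
  rw [hαγ, hsq] at key
  have hSpos : 0 < Real.sqrt (t / ν) := Real.sqrt_pos.2 (div_pos ht.1 hν)
  have hG2 : 0 < G ^ 2 := by positivity
  have key' : ‖fderiv ℝ (u t) x‖ ≤ C₁ / (G * Real.sqrt (t / ν)) / (ν / G ^ 2) := by
    rw [le_div_iff₀ (div_pos hν hG2)]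
    calc ‖fderiv ℝ (u t) x‖ * (ν / G ^ 2) = ν / G ^ 2 * ‖fderiv ℝ (u t) x‖ := mul_comm _ _
      _ ≤ C₁ / (G * Real.sqrt (t / ν)) := key
  calc ‖fderiv ℝ (u t) x‖ ≤ C₁ / (G * Real.sqrt (t / ν)) / (ν / G ^ 2) := key'
    _ = C₁ * G / Real.sqrt (ν * t) := by rw [hsq']; field_simp

/-! ### The data class of the crux: the early window -/

/-- **Scale-invariant early gradient bound for the data class.** There are absolute `C ≥ 0` and
`ε' > 0` such that every classical solution of the unforced Navier–Stokes system on `ℝ³ × [0,T)`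
(`ν, T > 0`) that is Leray–Hopf from a rapidly decaying datum with `‖u(0,·)‖ ≤ B₀` (`B₀ > 0`)
satisfies `‖∇u(τ, x)‖ ≤ C B₀/√(ντ)` for all `x` and all `τ ∈ (0,T)` with `τ < ε'ν/B₀²` (speed
`≤ 2B₀` in the early window, `levelSetModeration_earlyWindow`; `L²` slices from the energy
inequality; `earlyBookkeeping_norm_fderiv_le_of_speed_le` with `G = 2B₀`). [folklore] -/
theorem earlyBookkeeping_norm_fderiv_le :
    ∃ C ε' : ℝ, 0 ≤ C ∧ 0 < ε' ∧ ∀ (ν T : ℝ) (u : ℝ → EuclideanSpace ℝ (Fin 3) → EuclideanSpace ℝ (Fin 3)) (p : ℝ → EuclideanSpace ℝ (Fin 3) → ℝ), 0 < ν → 0 < T → Literature.Analysis.FluidPDE.IsClassicalNSSolutionOn (Set.Ico 0 T) ν 0 u p → Literature.Analysis.FluidPDE.IsLerayHopfOn T ν 0 (u 0) u → Literature.Analysis.FluidPDE.HasRapidSpatialDecay (u 0) → ∀ B₀ : ℝ, 0 < B₀ → (∀ x, ‖u 0 x‖ ≤ B₀) → ∀ τ ∈ Set.Ioo 0 T, τ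 < ε' * ν / B₀ ^ 2 → ∀ x, ‖fderiv ℝ (u τ) x‖ ≤ C * B₀ / Real.sqrt (ν * τ) := by
  obtain ⟨c₀, hc₀, hW⟩ := levelSetModeration_earlyWindow
  obtain ⟨C, hC0, hG⟩ := earlyBookkeeping_norm_fderiv_le_of_speed_le
  refine ⟨2 * C, min c₀ (1 / 4), by positivity, lt_min hc₀ (by norm_num), ?_⟩
  intro ν T u p hν hT hcl hLH hdec B₀ hB₀ hbd0 τ hτ hτε x
  -- the horizon `T' = (τ + T₁)/2`, `T₁ = min T (c₀ν/B₀²)`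
  set T₁ : ℝ := min T (c₀ * ν / B₀ ^ 2) with hT₁
  have hτc₀ : τ < c₀ * ν / B₀ ^ 2 := by
    refine lt_of_lt_of_le hτε ?_
    exact div_le_div_of_nonneg_right (mul_le_mul_of_nonneg_right (min_le_left _ _) hν.le)
      (by positivity)
  have hτT₁ : τ < T₁ := lt_min hτ.2 hτc₀
  set T' : ℝ := (τ + T₁) / 2 with hT'
  have hτT' : τ < T' := by rw [hT']; linarith
  have hT'T₁ : T' < T₁ := by rw [hT']; linarith
  have hT'pos : 0 < T' := hτ.1.trans hτT'
  have hT'T : T' < T := hT'T₁.trans_le (min_le_left _ _)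
  have hT'c : T' < c₀ * ν / B₀ ^ 2 := hT'T₁.trans_le (min_le_right _ _)
  -- speed `≤ 2B₀` on `[0, T']`
  have hbd : ∀ s ∈ Icc 0 T', ∀ y, ‖u s y‖ ≤ 2 * B₀ := fun s hs y =>
    (hW ν T u p hν hT hcl hLH hdec B₀ hB₀ hbd0 s ⟨hs.1, hs.2.trans_lt hT'T⟩
      (hs.2.trans_lt hT'c)).1 y
  -- uniform `L²` bound of the slices
  set KK : ℝ≥0∞ := (ENNReal.ofReal (∫ x, ‖u 0 x‖ ^ 2)) ^ (1 / 2 : ℝ) with hKK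
  have hKKtop : KK ≠ ⊤ := ENNReal.rpow_ne_top_of_nonneg (by norm_num) ENNReal.ofReal_ne_top
  have hL2 : ∀ s ∈ Icc 0 T', eLpNorm (u s) 2 volume ≤ KK := by
    intro s hs
    have h := lintegral_enorm_sq_le_of_lerayHopf hLH hν.le ⟨hs.1, hs.2.trans hT'T.le⟩
    rw [eLpNorm_eq_lintegral_rpow_enorm_toReal (by norm_num) (by norm_num), ENNReal.toReal_ofNat,
      hKK]
    refine ENNReal.rpow_le_rpow ?_ (by norm_num)
    refine le_trans (le_of_eq ?_) h
    exact lintegral_congr fun x => by rw [ENNReal.rpow_two]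
  -- `τ ≤ ν/(2B₀)²`
  have hτν : τ ≤ ν / (2 * B₀) ^ 2 := by
    have h1 : τ < 1 / 4 * ν / B₀ ^ 2 := by
      refine lt_of_lt_of_le hτε ?_
      exact div_le_div_of_nonneg_right (mul_le_mul_of_nonneg_right (min_le_right _ _) hν.le)
        (by positivity)
    refine h1.le.trans (le_of_eq ?_)
    field_simp
    ring
  have key := hG hν (by positivity : (0 : ℝ) < 2 * B₀) hcl hT'pos hT'T hbd hKKtop hL2 τ ⟨hτ.1, hτT'⟩
    hτν x
  calc ‖fderiv ℝ (u τ) x‖ ≤ C * (2 * B₀) / Real.sqrt (ν * τ) := key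
    _ = 2 * C * B₀ / Real.sqrt (ν * τ) := by ring

end Summit.NavierStokesRegularity.NavierStokesRegularity.Theorems

end
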